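import Summits.MatrixMultiplication.MatrixMultiplication.Theorems.FarEdgeDescentFirstPowerCeiling
import Summits.MatrixMultiplication.MatrixMultiplication.Theorems.FarEdgeDescentAnchorLaw
import Mathlib.Analysis.SpecialFunctions.Pow.Asymptotics
import HarnessLib

/-!
# Route `FarEdgeDescent` — the SPECIAL side lies beyond the first-power class, leaf and rungs alike
(lens-2 «special vs generic», gen 42; support module for the open split child `PowerAmortisation`
stmt-MatrixMultiplication-25347 of the special leaf `FiniteSaturation` 23739; def-free; cut of record UNCHANGED)

The special leaf's rate ladder `FiniteSaturation (23739) ⟹ PowerAmortisation (25347) ⟹ SubLogRate (25371)` is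
typed here as theorems (`powerAmortisation_of_finiteSaturation`, `subLogRate_of_powerAmortisation` — the
elementary `k^{−δ}·log k → 0`), and composed with gen 41's FIRST-POWER CEILING
(`FarEdgeDescentFirstPowerCeiling.omegaRect_lt_firstPower_of_subLogRate`: below the constant
`c₁ = (3/2)log 3 − 2 log 2` no instance `(q, σ, ρ)` of the full first-power Coppersmith–Winograd certificate
reaches the rate).  Consequence, by theorem: **if the special leaf — or merely its open child
`PowerAmortisation` — holds, then eventually in `k` the true profile `ω(1,k,1)` lies STRICTLY BELOW EVERY value
of the first-power CW method** (`omegaRect_lt_firstPower_of_powerAmortisation`,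
`omegaRect_lt_firstPower_of_finiteSaturation`); so no first-power CW analysis can ever certify the special
leaf or its child at any large `k` (method-class placement of the special side = the route's BC9 ceiling, now
for the LEAF and not only for the aside).  Under `ω = 2` the same holds (`omegaRect_lt_firstPower_of_mm`).
The generic side's companion statements are `FarEdgeDescentAnchorLaw` / `FarEdgeDescentLaplaceLaw` (gen 42).
[cite: CoppersmithWinograd1990, §§6–7] [cite: HuangPan1998, §2] [cite: LottiRomani1983, §2]
-/

set_option linter.dupNamespace false

noncomputable section

namespace Summit.MatrixMultiplication.MatrixMultiplication.Theorems.FarEdgeDescentPowerCeiling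

open Literature.Computability.AlgebraicComplexity Filter
open Summit.MatrixMultiplication.MatrixMultiplication.Theses.FarEdgeDescent
open Summit.MatrixMultiplication.MatrixMultiplication.Theorems.FarEdgeDescentChord
open Summit.MatrixMultiplication.MatrixMultiplication.Theorems.FarEdgeDescentLogRate
open Summit.MatrixMultiplication.MatrixMultiplication.Theorems.FarEdgeDescentFirstPowerCeiling

/-- **`FiniteSaturation ⟹ PowerAmortisation`** (the leaf implies its open child; elementary: `δ = 1`,
`C = K·e(1)` — below `K` the excess is at most `e(1) = C/K ≤ C/k`, from `K` on it vanishes). -/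
theorem powerAmortisation_of_finiteSaturation (hF : FiniteSaturation) : PowerAmortisation := by
  obtain ⟨K, hK2, hK⟩ := hF
  have hKpos : (0 : ℝ) < K := by exact_mod_cast (show 0 < K by omega)
  have he1 : 0 ≤ omegaRect ℂ 1 1 1 - 2 := excess_one_nonneg
  refine ⟨1, (K : ℝ) * (omegaRect ℂ 1 1 1 - 2), one_pos, fun k hk => ?_⟩
  have hkpos : (0 : ℝ) < k := by exact_mod_cast hk
  rw [Real.rpow_neg_one]
  rcases le_or_gt K k with hKk | hkK
  · -- from `K` on the excess vanishes
    have h := excess_antitone (x := (k : ℝ)) (y := (K : ℝ)) (by exact_mod_cast hKk)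
    rw [hK] at h
    have : 0 ≤ (K : ℝ) * (omegaRect ℂ 1 1 1 - 2) * ((k : ℝ))⁻¹ := by positivity
    linarith
  · -- below `K`: `e(k) ≤ e(1) = C/K ≤ C/k`
    have h := excess_antitone (x := (k : ℝ)) (y := 1) (by exact_mod_cast hk)
    have hkK' : (k : ℝ) ≤ K := by exact_mod_cast hkK.le
    have hinv : ((K : ℝ))⁻¹ ≤ ((k : ℝ))⁻¹ := by
      rw [inv_le_inv₀ hKpos hkpos]; exact hkK'
    calc omegaRect ℂ 1 (k : ℝ) 1 - ((k : ℝ) + 1) ≤ omegaRect ℂ 1 1 1 - 2 := by linarith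
      _ = (K : ℝ) * (omegaRect ℂ 1 1 1 - 2) * ((K : ℝ))⁻¹ := by field_simp
      _ ≤ (K : ℝ) * (omegaRect ℂ 1 1 1 - 2) * ((k : ℝ))⁻¹ :=
          mul_le_mul_of_nonneg_left hinv (by positivity)

/-- **`PowerAmortisation ⟹ SubLogRate`** (the open child implies the aside 25371): `C·k^{−δ}·log k → 0`,
via `log k ≤ k^{δ/2}/(δ/2)` (`Real.log_le_rpow_div`) and `k^{−δ/2} → 0`. -/
theorem subLogRate_of_powerAmortisation (h : PowerAmortisation) : SubLogRate := by
  obtain ⟨δ, C, hδ, H⟩ := h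
  intro c hc
  rcases le_or_gt C 0 with hC | hC
  · refine ⟨2, le_rfl, fun k hk => ?_⟩
    have h1 := H k (le_trans (by norm_num) hk)
    have hk2 : (2 : ℝ) ≤ k := by exact_mod_cast hk
    have hlog : 0 < Real.log k := Real.log_pos (by linarith)
    have hA : C * (k : ℝ) ^ (-δ) ≤ 0 :=
      mul_nonpos_of_nonpos_of_nonneg hC (Real.rpow_nonneg (by linarith) _)
    have hB : 0 ≤ c / Real.log k := div_nonneg hc.le hlog.le
    linarith
  · have hev : ∀ᶠ x : ℝ in atTop, x ^ (-(δ / 2)) ≤ c * δ / (2 * C) :=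
      (tendsto_rpow_neg_atTop (by linarith : 0 < δ / 2)).eventually
        (Iic_mem_nhds (by positivity : (0 : ℝ) < c * δ / (2 * C)))
    obtain ⟨k₀, hk₀⟩ := eventually_atTop.1 (tendsto_natCast_atTop_atTop.eventually hev)
    refine ⟨max k₀ 2, le_max_right _ _, fun k hk => ?_⟩
    have hkk₀ : k₀ ≤ k := le_trans (le_max_left _ _) hk
    have hk2n : 2 ≤ k := le_trans (le_max_right _ _) hk
    have hk2 : (2 : ℝ) ≤ k := by exact_mod_cast hk2n
    have hkpos : (0 : ℝ) < k := by linarith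
    have hlog : 0 < Real.log k := Real.log_pos (by linarith)
    have h1 := H k (le_trans (by norm_num) hk2n)
    have hsmall : (k : ℝ) ^ (-(δ / 2)) ≤ c * δ / (2 * C) := hk₀ k hkk₀
    have hlogle : Real.log k ≤ (k : ℝ) ^ (δ / 2) / (δ / 2) := Real.log_le_rpow_div hkpos.le (by linarith)
    rw [le_div_iff₀ hlog]
    have hsplit : (k : ℝ) ^ (-δ) = (k : ℝ) ^ (-(δ / 2)) * (k : ℝ) ^ (-(δ / 2)) := by
      rw [← Real.rpow_add hkpos]; ring_nf
    have hprod : (k : ℝ) ^ (-(δ / 2)) * (k : ℝ) ^ (δ / 2) = 1 := by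
      rw [← Real.rpow_add hkpos]; simp
    have hnn : 0 ≤ (k : ℝ) ^ (-δ) := Real.rpow_nonneg hkpos.le _
    calc (omegaRect ℂ 1 (k : ℝ) 1 - ((k : ℝ) + 1)) * Real.log k
        ≤ C * (k : ℝ) ^ (-δ) * Real.log k := mul_le_mul_of_nonneg_right h1 hlog.le
      _ ≤ C * (k : ℝ) ^ (-δ) * ((k : ℝ) ^ (δ / 2) / (δ / 2)) :=
          mul_le_mul_of_nonneg_left hlogle (by positivity)
      _ = 2 * C / δ * (k : ℝ) ^ (-(δ / 2)) * ((k : ℝ) ^ (-(δ / 2)) * (k : ℝ) ^ (δ / 2)) := by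
          rw [hsplit]; field_simp
      _ = 2 * C / δ * (k : ℝ) ^ (-(δ / 2)) := by rw [hprod, mul_one]
      _ ≤ 2 * C / δ * (c * δ / (2 * C)) := mul_le_mul_of_nonneg_left hsmall (by positivity)
      _ = c := by field_simp

/-- The special leaf implies the aside `SubLogRate`. -/
theorem subLogRate_of_finiteSaturation (hF : FiniteSaturation) : SubLogRate :=
  subLogRate_of_powerAmortisation (powerAmortisation_of_finiteSaturation hF)

/-- **The open child `PowerAmortisation` lies beyond the first-power class.**  If it holds then, eventually in
`k`, the true profile `ω(1,k,1)` is STRICTLY below the value of EVERY instance `(q ≥ 2, σ, ρ)` of the full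
first-power Coppersmith–Winograd certificate (gen 41 ceiling + `subLogRate_of_powerAmortisation`): no such
analysis certifies the child at any large `k`. [cite: CoppersmithWinograd1990, §§6–7] -/
theorem omegaRect_lt_firstPower_of_powerAmortisation (h : PowerAmortisation) :
    ∃ k₀ : ℕ, 2 ≤ k₀ ∧ ∀ k : ℕ, k₀ ≤ k → ∀ q : ℕ, 2 ≤ q → ∀ σ ρ : ℝ, 0 ≤ σ → 0 ≤ ρ → 2 * σ + ρ < 1 →
      omegaRect ℂ 1 k 1 < cwFullFirstPowerValue q k σ ρ :=
  omegaRect_lt_firstPower_of_subLogRate (subLogRate_of_powerAmortisation h)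

/-- **The special LEAF lies beyond the first-power class** (same conclusion from `FiniteSaturation`). -/
theorem omegaRect_lt_firstPower_of_finiteSaturation (hF : FiniteSaturation) :
    ∃ k₀ : ℕ, 2 ≤ k₀ ∧ ∀ k : ℕ, k₀ ≤ k → ∀ q : ℕ, 2 ≤ q → ∀ σ ρ : ℝ, 0 ≤ σ → 0 ≤ ρ → 2 * σ + ρ < 1 →
      omegaRect ℂ 1 k 1 < cwFullFirstPowerValue q k σ ρ :=
  omegaRect_lt_firstPower_of_subLogRate (subLogRate_of_finiteSaturation hF)

/-- And under the summit itself. -/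
theorem omegaRect_lt_firstPower_of_mm (hS : _root_.MatrixMultiplication) :
    ∃ k₀ : ℕ, 2 ≤ k₀ ∧ ∀ k : ℕ, k₀ ≤ k → ∀ q : ℕ, 2 ≤ q → ∀ σ ρ : ℝ, 0 ≤ σ → 0 ≤ ρ → 2 * σ + ρ < 1 →
      omegaRect ℂ 1 k 1 < cwFullFirstPowerValue q k σ ρ :=
  omegaRect_lt_firstPower_of_finiteSaturation (finiteSaturation_of_mm hS)

end Summit.MatrixMultiplication.MatrixMultiplication.Theorems.FarEdgeDescentPowerCeiling

end
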